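import Summits.QuantumFields.YangMills.Theorems.AllWindowsColdBoxBoxHighLineTiltCum5Trunc
import Summits.QuantumFields.YangMills.Theorems.AllWindowsColdBoxBoxHighLineTiltCum3Sizes

/-!
# U5-L3d (L3-concrete, stage 1): the fifth tilted cumulant `κ₅,t(c_x, c_y; tiltU)` over `μ_D` in SIZES, modulo the three `U`-slots

Continuation of ✓`…TiltCum5Trunc` (`GaussNormalForm.abs_tiltCum5_muD_tiltU_le`) in the pattern of w5 g23's K4 ✓`abs_tiltCum4_muD_le_of_sizes`
(planner ym-idea-2 g18's board 22:22:10Z «L3-concrete → fcl-p3»): the four PLAQUETTE slots are discharged at the Gaussian mean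
`m_x = gaussAvg β H (linCurvSq H (plaq12At x))` by w4 g28's ✓13K-M (`TiltSup.gaussAvg_sfInd_even_sub_mean_moments_le`, `…_odd_pow_four_le`) and
w5's ✓`PlaqObsL2.gaussAvg_chartPlaqCostOdd_sq_le`:

* `gaussAvg_sfInd_mul_chartPlaqCost_sub_mean_pow_le` — `E₀[1_D(c_x − m_x)²] ≤ C(1+log H)²/β²`, `E₀[1_D(c_x − m_x)⁴] ≤ C((1+log H)⁴/β⁴ + s⁶/β³)`;
* `k5_bookkeeping` — the pure-real collapse of the five-term bound;
* ★★ **`abs_tiltCum5_muD_le_of_sizes`** — for `H ≥ 1`, `β ≥ 1`, `0 < s ≤ 1`, `sup_D|tiltU| ≤ 1`, `E₀[1_D] ≥ 1/2` and ANY bounds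
  `E₀[1_D(tiltU − b)^k] ≤ RU_k` (`k = 2, 4, 6`):
  `|κ₅,t| ≤ C·[((1+log H)²/β² + s³/(β√β))·√RU₆ + (1+log H)²/β²·(√RU₂·√RU₄) + ((1+log H)²/β² + s³/(β√β))·(RU₂·√RU₂)]` for all `t ∈ [0,1]`, `x, y`
  — with the expected `RU_k ≍ (H⁴/β)^{k/2}·polylog` (V₃-dominated) every term is `≍ H⁶β^{−7/2}·polylog`, U5-BLOCKERS §2 L3's size of `f‴`.

Stage 2 (NOT here): the `U`-slots `RU₄, RU₆` from V₃-hypercontractivity (w5's ⧗`cubicVertexPoly` + ✓`gaussAvg_pow_even_le_of_polyCert`) and the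
even-part fluctuations.  Tree + Mathlib; no definitions; standard axioms.  HONEST LABEL: U5 prep, helper; U5 ⟨stmt-QuantumFields-24336⟩, ⟨24004⟩ OPEN;
route AllWindowsColdBox DRAFT; the Yang–Mills mass gap is NOT proved by this file; no summit is proved by a line.  Seat ym-line-fcl-p3 g26.
-/

set_option autoImplicit false

noncomputable section

open MeasureTheory Set Real
open Literature.Probability.LatticeModels (Site)
open Summit.QuantumFields.YangMills.Theorems.WeakCouplingRates (plaq12At)

namespace Summit.QuantumFields.YangMills.Theorems.AllWindowsColdBoxBoxHighLine

namespace GaussNormalForm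

/-! ## §1 The plaquette slots at the Gaussian mean -/

/-- `E₀[1_D(c_x − m_x)²] ≤ C(1+log H)²/β²` and `E₀[1_D(c_x − m_x)⁴] ≤ C((1+log H)⁴/β⁴ + s⁶/β³)` at the Gaussian mean `m_x = E₀[|ℓ_x|²]`
(`c = Ẽ + O + m_x`: `(Ẽ+O)² ≤ 2Ẽ² + 2O²`, `(Ẽ+O)⁴ ≤ 8Ẽ⁴ + 8O⁴`, ✓13K-M for `Ẽ`, ✓12-odd for `O`). -/
theorem gaussAvg_sfInd_mul_chartPlaqCost_sub_mean_pow_le : ∃ C : ℝ, 0 ≤ C ∧ ∀ H : ℕ, 1 ≤ H → ∀ β : ℝ, 1 ≤ β →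
    ∀ s : ℝ, 0 ≤ s → s ≤ 1 → ∀ x : Site 4,
      gaussAvg β H (fun a => sfInd H s a * (chartPlaqCost H x 1 2 a - gaussAvg β H (linCurvSq H (plaq12At x))) ^ 2) ≤
          C * (1 + Real.log H) ^ 2 / β ^ 2 ∧
      gaussAvg β H (fun a => sfInd H s a * (chartPlaqCost H x 1 2 a - gaussAvg β H (linCurvSq H (plaq12At x))) ^ 4) ≤
          C * ((1 + Real.log H) ^ 4 / β ^ 4 + s ^ 6 / β ^ 3) := by
  obtain ⟨C_E, hC_E0, hE⟩ := TiltSup.gaussAvg_sfInd_even_sub_mean_moments_le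
  obtain ⟨C_O, hC_O0, hO4⟩ := TiltSup.gaussAvg_sfInd_odd_pow_four_le
  set K_O : ℝ := 2888 * (60 * 1036 ^ 2 + 81 * (60 * 1036 ^ 2) ^ 2) with hK_O
  have hK_O0 : 0 ≤ K_O := by rw [hK_O]; positivity
  refine ⟨2 * C_E + 2 * K_O + 8 * C_E + 8 * C_O, by positivity, fun H hH β hβ s hs0 hs1 x => ?_⟩
  have hH1 : (1 : ℝ) ≤ H := by exact_mod_cast hH
  have hβ0 : 0 < β := by linarith
  have hL1 : 1 ≤ 1 + Real.log (H : ℝ) := by have := Real.log_nonneg hH1; linarith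
  obtain ⟨hE2, hE4⟩ := hE H hH β hβ s hs0 hs1 x
  have hO := hO4 H hH β hβ s hs0 hs1 x
  have hO2 := PlaqObsL2.gaussAvg_chartPlaqCostOdd_sq_le (H := H) (x := x) (μ := 1) (ν := 2) hβ0
  set m := gaussAvg β H (linCurvSq H (plaq12At x)) with hm
  -- abbreviations: `Et a = c − O − m`, `O a`
  have hsf := fun a : LandauFree H → E3 => TiltSup.sfInd_nonneg_le_one (H := H) s a
  have hmc : Measurable (chartPlaqCost H x 1 2) := EdgeChartGaussian.measurable_chartPlaqCost H x 1 2
  have hmo : Measurable (chartPlaqCostOdd H x 1 2) := EdgeChartGaussian.measurable_chartPlaqCostOdd H x 1 2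
  have hcb : ∀ a, |chartPlaqCost H x 1 2 a| ≤ 4 := fun a => TiltSup.abs_chartPlaqCost_le_four (H := H) x 1 2 a
  have hob : ∀ a, |chartPlaqCostOdd H x 1 2 a| ≤ 4 := fun a => PlaqObsL2.abs_chartPlaqCostOdd_le_four (H := H) (x := x) (μ := 1) (ν := 2) a
  have hmsf : Measurable (sfInd H s) := Tilt.measurable_sfInd H s
  -- bounded pieces: `|Ẽ| ≤ 8 + |m|`
  have hEtb : ∀ a, |chartPlaqCost H x 1 2 a - chartPlaqCostOdd H x 1 2 a - m| ≤ 8 + |m| := fun a => by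
    have h1 := hcb a; have h2 := hob a
    have := abs_sub (chartPlaqCost H x 1 2 a - chartPlaqCostOdd H x 1 2 a) m
    have := abs_sub (chartPlaqCost H x 1 2 a) (chartPlaqCostOdd H x 1 2 a)
    linarith
  have hmEt : Measurable fun a => chartPlaqCost H x 1 2 a - chartPlaqCostOdd H x 1 2 a - m := (hmc.sub hmo).sub measurable_const
  -- integrability of the dominating functions
  have IEt2 : Integrable fun a => (sfInd H s a * (chartPlaqCost H x 1 2 a - chartPlaqCostOdd H x 1 2 a - m) ^ 2) * gaussWeight β H a :=
    Tilt.integrable_bdd_mul_gaussWeight H hβ0 (hmsf.mul (hmEt.pow_const 2)) (C := 1 * (8 + |m|) ^ 2) fun a => by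
      rw [abs_mul, abs_of_nonneg (hsf a).1]
      exact mul_le_mul (hsf a).2 (Tilt.abs_pow_le_pow hEtb 2 a) (abs_nonneg _) zero_le_one
  have IO2 : Integrable fun a => chartPlaqCostOdd H x 1 2 a ^ 2 * gaussWeight β H a :=
    Tilt.integrable_bdd_mul_gaussWeight H hβ0 (hmo.pow_const 2) (Tilt.abs_pow_le_pow hob 2)
  have IEt4 : Integrable fun a => (sfInd H s a * (chartPlaqCost H x 1 2 a - chartPlaqCostOdd H x 1 2 a - m) ^ 4) * gaussWeight β H a :=
    Tilt.integrable_bdd_mul_gaussWeight H hβ0 (hmsf.mul (hmEt.pow_const 4)) (C := 1 * (8 + |m|) ^ 4) fun a => by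
      rw [abs_mul, abs_of_nonneg (hsf a).1]
      exact mul_le_mul (hsf a).2 (Tilt.abs_pow_le_pow hEtb 4 a) (abs_nonneg _) zero_le_one
  have IO4 : Integrable fun a => (sfInd H s a * chartPlaqCostOdd H x 1 2 a ^ 4) * gaussWeight β H a :=
    Tilt.integrable_bdd_mul_gaussWeight H hβ0 (hmsf.mul (hmo.pow_const 4)) (C := 1 * 4 ^ 4) fun a => by
      rw [abs_mul, abs_of_nonneg (hsf a).1]
      exact mul_le_mul (hsf a).2 (Tilt.abs_pow_le_pow hob 4 a) (abs_nonneg _) zero_le_one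
  have J1 : Integrable fun a => (2 * (sfInd H s a * (chartPlaqCost H x 1 2 a - chartPlaqCostOdd H x 1 2 a - m) ^ 2)) * gaussWeight β H a :=
    (IEt2.const_mul 2).congr (Filter.Eventually.of_forall fun a => by ring)
  have J2 : Integrable fun a => (2 * chartPlaqCostOdd H x 1 2 a ^ 2) * gaussWeight β H a :=
    (IO2.const_mul 2).congr (Filter.Eventually.of_forall fun a => by ring)
  have J3 : Integrable fun a => (8 * (sfInd H s a * (chartPlaqCost H x 1 2 a - chartPlaqCostOdd H x 1 2 a - m) ^ 4)) * gaussWeight β H a :=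
    (IEt4.const_mul 8).congr (Filter.Eventually.of_forall fun a => by ring)
  have J4 : Integrable fun a => (8 * (sfInd H s a * chartPlaqCostOdd H x 1 2 a ^ 4)) * gaussWeight β H a :=
    (IO4.const_mul 8).congr (Filter.Eventually.of_forall fun a => by ring)
  have I2 : Integrable fun a => (2 * (sfInd H s a * (chartPlaqCost H x 1 2 a - chartPlaqCostOdd H x 1 2 a - m) ^ 2) +
      2 * chartPlaqCostOdd H x 1 2 a ^ 2) * gaussWeight β H a :=
    (J1.add J2).congr (Filter.Eventually.of_forall fun a => by simp only [Pi.add_apply]; ring)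
  have I4 : Integrable fun a => (8 * (sfInd H s a * (chartPlaqCost H x 1 2 a - chartPlaqCostOdd H x 1 2 a - m) ^ 4) +
      8 * (sfInd H s a * chartPlaqCostOdd H x 1 2 a ^ 4)) * gaussWeight β H a :=
    (J3.add J4).congr (Filter.Eventually.of_forall fun a => by simp only [Pi.add_apply]; ring)
  -- pointwise dominations
  have hp2 : ∀ a, sfInd H s a * (chartPlaqCost H x 1 2 a - m) ^ 2 ≤
      2 * (sfInd H s a * (chartPlaqCost H x 1 2 a - chartPlaqCostOdd H x 1 2 a - m) ^ 2) + 2 * chartPlaqCostOdd H x 1 2 a ^ 2 := by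
    intro a
    obtain ⟨h0, h1⟩ := hsf a
    set E := chartPlaqCost H x 1 2 a - chartPlaqCostOdd H x 1 2 a - m
    set O := chartPlaqCostOdd H x 1 2 a
    have e : chartPlaqCost H x 1 2 a - m = E + O := by simp only [E, O]; ring
    rw [e]
    nlinarith [sq_nonneg (E - O), mul_nonneg h0 (sq_nonneg (E - O)), mul_le_mul_of_nonneg_right h1 (sq_nonneg O), sq_nonneg O]
  have hp4 : ∀ a, sfInd H s a * (chartPlaqCost H x 1 2 a - m) ^ 4 ≤
      8 * (sfInd H s a * (chartPlaqCost H x 1 2 a - chartPlaqCostOdd H x 1 2 a - m) ^ 4) + 8 * (sfInd H s a * chartPlaqCostOdd H x 1 2 a ^ 4) := by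
    intro a
    obtain ⟨h0, _⟩ := hsf a
    set E := chartPlaqCost H x 1 2 a - chartPlaqCostOdd H x 1 2 a - m
    set O := chartPlaqCostOdd H x 1 2 a
    have e : chartPlaqCost H x 1 2 a - m = E + O := by simp only [E, O]; ring
    rw [e]
    have key : 8 * (E ^ 4 + O ^ 4) - (E + O) ^ 4 = (E - O) ^ 2 * (6 * (E + O) ^ 2 + (E - O) ^ 2) := by ring
    have h4 : (E + O) ^ 4 ≤ 8 * (E ^ 4 + O ^ 4) := by nlinarith [mul_nonneg (sq_nonneg (E - O)) (by positivity : (0:ℝ) ≤ 6 * (E + O) ^ 2 + (E - O) ^ 2)]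
    have := mul_le_mul_of_nonneg_left h4 h0
    linarith
  constructor
  · have hmono := EdgeChartGaussian.gaussAvg_mono_of_nonneg H hβ0 (fun a => mul_nonneg (hsf a).1 (sq_nonneg _)) hp2 I2
    rw [EdgeChartGaussian.gaussAvg_add β H J1 J2, EdgeChartGaussian.gaussAvg_const_mul, EdgeChartGaussian.gaussAvg_const_mul] at hmono
    have hb3 : K_O / β ^ 3 ≤ K_O * (1 + Real.log H) ^ 2 / β ^ 2 := by
      have h1 : K_O / β ^ 3 ≤ K_O / β ^ 2 :=
        div_le_div_of_nonneg_left hK_O0 (by positivity) (pow_le_pow_right₀ hβ (by norm_num))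
      have h2 : K_O / β ^ 2 ≤ K_O * (1 + Real.log H) ^ 2 / β ^ 2 := by
        apply div_le_div_of_nonneg_right _ (by positivity)
        have := one_le_pow₀ (n := 2) hL1
        nlinarith
      exact h1.trans h2
    calc _ ≤ 2 * gaussAvg β H (fun a => sfInd H s a * (chartPlaqCost H x 1 2 a - chartPlaqCostOdd H x 1 2 a - m) ^ 2) +
          2 * gaussAvg β H (fun a => chartPlaqCostOdd H x 1 2 a ^ 2) := hmono
      _ ≤ 2 * (C_E * (1 + Real.log H) ^ 2 / β ^ 2) + 2 * (K_O / β ^ 3) :=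
          add_le_add (mul_le_mul_of_nonneg_left hE2 zero_le_two) (mul_le_mul_of_nonneg_left hO2 zero_le_two)
      _ ≤ 2 * (C_E * (1 + Real.log H) ^ 2 / β ^ 2) + 2 * (K_O * (1 + Real.log H) ^ 2 / β ^ 2) := by linarith
      _ = (2 * C_E + 2 * K_O) * ((1 + Real.log H) ^ 2 / β ^ 2) := by ring
      _ ≤ (2 * C_E + 2 * K_O + 8 * C_E + 8 * C_O) * ((1 + Real.log H) ^ 2 / β ^ 2) :=
          mul_le_mul_of_nonneg_right (by linarith) (by positivity)
      _ = _ := by ring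
  · have hmono := EdgeChartGaussian.gaussAvg_mono_of_nonneg H hβ0 (fun a => mul_nonneg (hsf a).1 (by positivity)) hp4 I4
    rw [EdgeChartGaussian.gaussAvg_add β H J3 J4, EdgeChartGaussian.gaussAvg_const_mul, EdgeChartGaussian.gaussAvg_const_mul] at hmono
    have hA0 : 0 ≤ (1 + Real.log (H : ℝ)) ^ 4 / β ^ 4 := by positivity
    have hS0 : 0 ≤ s ^ 6 / β ^ 3 := by positivity
    calc _ ≤ 8 * gaussAvg β H (fun a => sfInd H s a * (chartPlaqCost H x 1 2 a - chartPlaqCostOdd H x 1 2 a - m) ^ 4) +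
          8 * gaussAvg β H (fun a => sfInd H s a * chartPlaqCostOdd H x 1 2 a ^ 4) := hmono
      _ ≤ 8 * (C_E * (1 + Real.log H) ^ 4 / β ^ 4) + 8 * (C_O * s ^ 6 / β ^ 3) :=
          add_le_add (mul_le_mul_of_nonneg_left hE4 (by norm_num)) (mul_le_mul_of_nonneg_left hO (by norm_num))
      _ = (8 * C_E) * ((1 + Real.log H) ^ 4 / β ^ 4) + (8 * C_O) * (s ^ 6 / β ^ 3) := by ring
      _ ≤ (2 * C_E + 2 * K_O + 8 * C_E + 8 * C_O) * ((1 + Real.log H) ^ 4 / β ^ 4) +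
          (2 * C_E + 2 * K_O + 8 * C_E + 8 * C_O) * (s ^ 6 / β ^ 3) :=
          add_le_add (mul_le_mul_of_nonneg_right (by linarith) hA0) (mul_le_mul_of_nonneg_right (by linarith) hS0)
      _ = _ := by ring

/-! ## §2 Pure-real collapse of the five-term bound -/

/-- The five-term bound of ✓`abs_tiltCum5_muD_tiltU_le` is monotone in its seven slots; substituting `mᵢ ≤ KP²·A`, `qᵢ ≤ KP²A² + KP²Sg²`,
`u₂ ≤ K²(√RU₂)²`, `u₄ ≤ K²RU₄`, `u₆ ≤ K²RU₆` collapses it to three monomials. -/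
theorem k5_bookkeeping {K KP A Sg RU2 RU4 RU6 m1 m2 q1 q2 u2 u4 u6 : ℝ} (hK : 0 ≤ K) (hKP : 0 ≤ KP) (hA : 0 ≤ A) (hSg : 0 ≤ Sg)
    (h2 : 0 ≤ RU2)
    (hm1 : m1 ≤ KP ^ 2 * A) (hm2 : m2 ≤ KP ^ 2 * A) (hq1 : q1 ≤ KP ^ 2 * A ^ 2 + KP ^ 2 * Sg ^ 2) (hq2 : q2 ≤ KP ^ 2 * A ^ 2 + KP ^ 2 * Sg ^ 2)
    (hb2 : u2 ≤ K ^ 2 * Real.sqrt RU2 ^ 2) (hb4 : u4 ≤ K ^ 2 * RU4) (hb6 : u6 ≤ K ^ 2 * RU6) :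
    Real.sqrt (Real.sqrt (16 * q1) * Real.sqrt (16 * q2)) * Real.sqrt (64 * u6) +
        Real.sqrt m1 * Real.sqrt m2 * (Real.sqrt u2 * Real.sqrt (16 * u4)) +
        3 * (Real.sqrt m1 * Real.sqrt u2 * (Real.sqrt m2 * Real.sqrt (16 * u4))) +
        3 * (Real.sqrt m2 * Real.sqrt u2 * (Real.sqrt m1 * Real.sqrt (16 * u4))) +
        3 * (u2 * (Real.sqrt (Real.sqrt (16 * q1) * Real.sqrt (16 * q2)) * Real.sqrt u2)) ≤
      32 * KP * K * ((A + Sg) * Real.sqrt RU6) + 28 * KP ^ 2 * K ^ 2 * (A * (Real.sqrt RU2 * Real.sqrt RU4)) +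
        12 * K ^ 3 * KP * ((A + Sg) * (RU2 * Real.sqrt RU2)) := by
  set Mb := KP ^ 2 * A with hMb
  set Qb := KP ^ 2 * A ^ 2 + KP ^ 2 * Sg ^ 2 with hQb
  have hMb0 : 0 ≤ Mb := by positivity
  have hQb0 : 0 ≤ Qb := by positivity
  -- monotone substitution
  have h' : Real.sqrt (Real.sqrt (16 * q1) * Real.sqrt (16 * q2)) * Real.sqrt (64 * u6) +
        Real.sqrt m1 * Real.sqrt m2 * (Real.sqrt u2 * Real.sqrt (16 * u4)) +
        3 * (Real.sqrt m1 * Real.sqrt u2 * (Real.sqrt m2 * Real.sqrt (16 * u4))) +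
        3 * (Real.sqrt m2 * Real.sqrt u2 * (Real.sqrt m1 * Real.sqrt (16 * u4))) +
        3 * (u2 * (Real.sqrt (Real.sqrt (16 * q1) * Real.sqrt (16 * q2)) * Real.sqrt u2)) ≤
      Real.sqrt (Real.sqrt (16 * Qb) * Real.sqrt (16 * Qb)) * Real.sqrt (64 * (K ^ 2 * RU6)) +
        Real.sqrt Mb * Real.sqrt Mb * (Real.sqrt (K ^ 2 * Real.sqrt RU2 ^ 2) * Real.sqrt (16 * (K ^ 2 * RU4))) +
        3 * (Real.sqrt Mb * Real.sqrt (K ^ 2 * Real.sqrt RU2 ^ 2) * (Real.sqrt Mb * Real.sqrt (16 * (K ^ 2 * RU4)))) +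
        3 * (Real.sqrt Mb * Real.sqrt (K ^ 2 * Real.sqrt RU2 ^ 2) * (Real.sqrt Mb * Real.sqrt (16 * (K ^ 2 * RU4)))) +
        3 * (K ^ 2 * Real.sqrt RU2 ^ 2 * (Real.sqrt (Real.sqrt (16 * Qb) * Real.sqrt (16 * Qb)) * Real.sqrt (K ^ 2 * Real.sqrt RU2 ^ 2))) := by
    gcongr
  -- collapse of the square roots
  have re3 : ∀ p q r : ℝ, p * q * (p * r) = p * p * (q * r) := fun p q r => by ring
  rw [re3, Real.mul_self_sqrt hMb0, sqrt_sqrt_mul_self (by positivity : (0:ℝ) ≤ 16 * Qb)] at h'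
  have hs64 : Real.sqrt (64 * (K ^ 2 * RU6)) = 8 * K * Real.sqrt RU6 := by
    rw [show 64 * (K ^ 2 * RU6) = (8 * K) ^ 2 * RU6 by ring, Real.sqrt_mul (by positivity) RU6, Real.sqrt_sq (by positivity)]
  have hs16 : Real.sqrt (16 * (K ^ 2 * RU4)) = 4 * K * Real.sqrt RU4 := by
    rw [show 16 * (K ^ 2 * RU4) = (4 * K) ^ 2 * RU4 by ring, Real.sqrt_mul (by positivity) RU4, Real.sqrt_sq (by positivity)]
  have hsu2 : Real.sqrt (K ^ 2 * Real.sqrt RU2 ^ 2) = K * Real.sqrt RU2 := by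
    rw [show K ^ 2 * Real.sqrt RU2 ^ 2 = (K * Real.sqrt RU2) ^ 2 by ring, Real.sqrt_sq (by positivity)]
  rw [hs64, hs16, hsu2] at h'
  -- `√(16·Qb) ≤ 4·KP·(A + Sg)`
  have hP1 : Real.sqrt (16 * Qb) ≤ 4 * KP * (A + Sg) := by
    rw [show 16 * Qb = (4 * KP) ^ 2 * (A ^ 2 + Sg ^ 2) by rw [hQb]; ring, Real.sqrt_mul (by positivity) _, Real.sqrt_sq (by positivity)]
    have : Real.sqrt (A ^ 2 + Sg ^ 2) ≤ A + Sg := by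
      rw [show A + Sg = Real.sqrt ((A + Sg) ^ 2) by rw [Real.sqrt_sq (by positivity)]]
      exact Real.sqrt_le_sqrt (by nlinarith [mul_nonneg hA hSg])
    exact mul_le_mul_of_nonneg_left this (by positivity)
  have t1 : Real.sqrt (16 * Qb) * (8 * K * Real.sqrt RU6) ≤ 4 * KP * (A + Sg) * (8 * K * Real.sqrt RU6) :=
    mul_le_mul_of_nonneg_right hP1 (by positivity)
  have t3 : K ^ 2 * Real.sqrt RU2 ^ 2 * (Real.sqrt (16 * Qb) * (K * Real.sqrt RU2)) ≤
      K ^ 2 * Real.sqrt RU2 ^ 2 * (4 * KP * (A + Sg) * (K * Real.sqrt RU2)) :=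
    mul_le_mul_of_nonneg_left (mul_le_mul_of_nonneg_right hP1 (by positivity)) (by positivity)
  have e : 4 * KP * (A + Sg) * (8 * K * Real.sqrt RU6) +
      Mb * (K * Real.sqrt RU2 * (4 * K * Real.sqrt RU4)) + 3 * (Mb * (K * Real.sqrt RU2 * (4 * K * Real.sqrt RU4))) +
      3 * (Mb * (K * Real.sqrt RU2 * (4 * K * Real.sqrt RU4))) +
      3 * (K ^ 2 * Real.sqrt RU2 ^ 2 * (4 * KP * (A + Sg) * (K * Real.sqrt RU2))) =
      32 * KP * K * ((A + Sg) * Real.sqrt RU6) + 28 * KP ^ 2 * K ^ 2 * (A * (Real.sqrt RU2 * Real.sqrt RU4)) +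
      12 * K ^ 3 * KP * ((A + Sg) * (RU2 * Real.sqrt RU2)) := by
    rw [hMb, Real.sq_sqrt h2]; ring
  linarith [h', t1, t3, e.le]

/-! ## §3 The fifth cumulant in sizes, modulo the three `U`-slots -/

/-- ★★ **`κ₅,t(c_x, c_y; tiltU)` over `μ_D` in SIZES, modulo the `U`-slots**: for `H ≥ 1`, `β ≥ 1`, `0 < s ≤ 1`, `sup_D|tiltU| ≤ 1`, `E₀[1_D] ≥ 1/2`
and any bounds `E₀[1_D(tiltU − b)^k] ≤ RU_k` (`k = 2,4,6`), for all sites `x, y` and `t ∈ [0,1]`: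
`|κ₅,t| ≤ C·[((1+log H)²/β² + s³/(β√β))·√RU₆ + (1+log H)²/β²·(√RU₂·√RU₄) + ((1+log H)²/β² + s³/(β√β))·(RU₂·√RU₂)]`. -/
theorem abs_tiltCum5_muD_le_of_sizes : ∃ C : ℝ, 0 ≤ C ∧ ∀ H : ℕ, 1 ≤ H → ∀ β : ℝ, 1 ≤ β → ∀ s : ℝ, 0 < s → s ≤ 1 →
    (∀ a ∈ smallField H s, |tiltU β H a| ≤ 1) → 1 / 2 ≤ gaussAvg β H (sfInd H s) →
    ∀ b RU2 RU4 RU6 : ℝ, 0 ≤ RU2 → 0 ≤ RU4 → 0 ≤ RU6 →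
      gaussAvg β H (fun a => sfInd H s a * (tiltU β H a - b) ^ 2) ≤ RU2 →
      gaussAvg β H (fun a => sfInd H s a * (tiltU β H a - b) ^ 4) ≤ RU4 →
      gaussAvg β H (fun a => sfInd H s a * (tiltU β H a - b) ^ 6) ≤ RU6 →
    ∀ (x y : Site 4), ∀ t ∈ Set.Icc (0 : ℝ) 1,
      |Tilt.tiltCum5 ((volume.restrict (smallField H s)).withDensity fun a => ENNReal.ofReal (gaussWeight β H a))
          (tiltU β H) t (chartPlaqCost H x 1 2) (chartPlaqCost H y 1 2)| ≤
        C * (((1 + Real.log H) ^ 2 / β ^ 2 + s ^ 3 / (β * Real.sqrt β)) * Real.sqrt RU6 +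
              (1 + Real.log H) ^ 2 / β ^ 2 * (Real.sqrt RU2 * Real.sqrt RU4) +
              ((1 + Real.log H) ^ 2 / β ^ 2 + s ^ 3 / (β * Real.sqrt β)) * (RU2 * Real.sqrt RU2)) := by
  obtain ⟨C_P, hC_P0, hP⟩ := gaussAvg_sfInd_mul_chartPlaqCost_sub_mean_pow_le
  obtain ⟨K, hKdef⟩ : ∃ K : ℝ, K = Real.sqrt (2 * Real.exp 2) := ⟨_, rfl⟩
  obtain ⟨KP, hKPdef⟩ : ∃ KP : ℝ, KP = Real.sqrt (2 * Real.exp 2 * C_P) := ⟨_, rfl⟩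
  have hK0 : 0 ≤ K := by rw [hKdef]; exact Real.sqrt_nonneg _
  have hKP0 : 0 ≤ KP := by rw [hKPdef]; exact Real.sqrt_nonneg _
  have hK2 : K ^ 2 = 2 * Real.exp 2 := by rw [hKdef]; exact Real.sq_sqrt (by positivity)
  have hKP2 : KP ^ 2 = 2 * Real.exp 2 * C_P := by rw [hKPdef]; exact Real.sq_sqrt (by positivity)
  refine ⟨32 * KP * K + 28 * KP ^ 2 * K ^ 2 + 12 * K ^ 3 * KP, by positivity,
    fun H hH β hβ s hs0 hs1 hU1 hD b RU2 RU4 RU6 h20 h40 h60 hR2 hR4 hR6 x y t ht => ?_⟩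
  obtain ⟨ht0, ht1⟩ := ht
  have hH1 : (1 : ℝ) ≤ H := by exact_mod_cast hH
  have hβ0 : 0 < β := lt_of_lt_of_le one_pos hβ
  have hDpos := integral_sfInd_mul_gaussWeight_pos (H := H) hβ0 hD
  have hsf := fun a : LandauFree H → E3 => TiltSup.sfInd_nonneg_le_one (H := H) s a
  -- the two size parameters
  have hA0 : 0 ≤ (1 + Real.log (H : ℝ)) ^ 2 / β ^ 2 := by positivity
  have hSg0 : 0 ≤ s ^ 3 / (β * Real.sqrt β) := by positivity
  have hA2 : ((1 + Real.log (H : ℝ)) ^ 2 / β ^ 2) ^ 2 = (1 + Real.log (H : ℝ)) ^ 4 / β ^ 4 := by ring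
  have hSg2 : (s ^ 3 / (β * Real.sqrt β)) ^ 2 = s ^ 6 / β ^ 3 := by
    rw [div_pow, mul_pow, Real.sq_sqrt hβ0.le]; ring
  -- sizes of the numerators
  obtain ⟨hP2x, hP4x⟩ := hP H hH β hβ s hs0.le hs1 x
  obtain ⟨hP2y, hP4y⟩ := hP H hH β hβ s hs0.le hs1 y
  -- `e^{2t}·(X/E₀[1_D]) ≤ e²·(2S)` whenever `0 ≤ X ≤ S`
  have hEle : Real.exp (2 * t * 1) ≤ Real.exp 2 := Real.exp_le_exp.2 (by linarith)
  have step : ∀ {X S : ℝ}, 0 ≤ X → X ≤ S → Real.exp (2 * t * 1) * (X / gaussAvg β H (sfInd H s)) ≤ Real.exp 2 * (2 * S) := by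
    intro X S hX hXS
    have h1 : X / gaussAvg β H (sfInd H s) ≤ 2 * X := div_le_two_mul_of_half_le hX hD
    have h2 : 0 ≤ X / gaussAvg β H (sfInd H s) := div_nonneg hX (le_trans (by norm_num) hD)
    exact mul_le_mul hEle (by linarith) h2 (by positivity)
  have n2 : ∀ (G : (LandauFree H → E3) → ℝ) (r : ℝ) {n : ℕ}, Even n → 0 ≤ gaussAvg β H (fun a => sfInd H s a * (G a - r) ^ n) :=
    fun G r n hn => EdgeChartGaussian.gaussAvg_nonneg H hβ0 fun a => mul_nonneg (hsf a).1 (hn.pow_nonneg _)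
  have ev2 : Even 2 := by decide
  have ev4 : Even 4 := by decide
  have ev6 : Even 6 := by decide
  have eM : Real.exp 2 * (2 * (C_P * (1 + Real.log H) ^ 2 / β ^ 2)) = KP ^ 2 * ((1 + Real.log (H : ℝ)) ^ 2 / β ^ 2) := by
    rw [hKP2]; ring
  have eQ : Real.exp 2 * (2 * (C_P * ((1 + Real.log H) ^ 4 / β ^ 4 + s ^ 6 / β ^ 3))) =
      KP ^ 2 * ((1 + Real.log (H : ℝ)) ^ 2 / β ^ 2) ^ 2 + KP ^ 2 * (s ^ 3 / (β * Real.sqrt β)) ^ 2 := by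
    rw [hKP2, hA2, hSg2]; ring
  have eU2 : Real.exp 2 * (2 * RU2) = K ^ 2 * Real.sqrt RU2 ^ 2 := by rw [hK2, Real.sq_sqrt h20]; ring
  have eU4 : Real.exp 2 * (2 * RU4) = K ^ 2 * RU4 := by rw [hK2]; ring
  have eU6 : Real.exp 2 * (2 * RU6) = K ^ 2 * RU6 := by rw [hK2]; ring
  have r2x := (step (n2 (chartPlaqCost H x 1 2) (gaussAvg β H (linCurvSq H (plaq12At x))) ev2) hP2x).trans_eq eM
  have r2y := (step (n2 (chartPlaqCost H y 1 2) (gaussAvg β H (linCurvSq H (plaq12At y))) ev2) hP2y).trans_eq eM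
  have r4x := (step (n2 (chartPlaqCost H x 1 2) (gaussAvg β H (linCurvSq H (plaq12At x))) ev4) hP4x).trans_eq eQ
  have r4y := (step (n2 (chartPlaqCost H y 1 2) (gaussAvg β H (linCurvSq H (plaq12At y))) ev4) hP4y).trans_eq eQ
  have ru2 := (step (n2 (tiltU β H) b ev2) hR2).trans_eq eU2
  have ru4 := (step (n2 (tiltU β H) b ev4) hR4).trans_eq eU4
  have ru6 := (step (n2 (tiltU β H) b ev6) hR6).trans_eq eU6
  -- the abstract bound along the untruncated tilt at the Gaussian means, collapsed
  have h := (abs_tiltCum5_muD_tiltU_le (H := H) hβ0 hDpos zero_le_one hU1 ht0 x y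
    (gaussAvg β H (linCurvSq H (plaq12At x))) (gaussAvg β H (linCurvSq H (plaq12At y))) b).trans
    (k5_bookkeeping hK0 hKP0 hA0 hSg0 h20 r2x r2y r4x r4y ru2 ru4 ru6)
  -- the constant
  have X1 : 0 ≤ ((1 + Real.log (H : ℝ)) ^ 2 / β ^ 2 + s ^ 3 / (β * Real.sqrt β)) * Real.sqrt RU6 := by positivity
  have X2 : 0 ≤ (1 + Real.log (H : ℝ)) ^ 2 / β ^ 2 * (Real.sqrt RU2 * Real.sqrt RU4) := by positivity
  have X3 : 0 ≤ ((1 + Real.log (H : ℝ)) ^ 2 / β ^ 2 + s ^ 3 / (β * Real.sqrt β)) * (RU2 * Real.sqrt RU2) := by positivity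
  have hKK : 0 ≤ KP ^ 2 * K ^ 2 := by positivity
  have hK3 : 0 ≤ K ^ 3 * KP := by positivity
  have hK1 : 0 ≤ KP * K := by positivity
  have c1 : 32 * KP * K ≤ 32 * KP * K + 28 * KP ^ 2 * K ^ 2 + 12 * K ^ 3 * KP := by linarith only [hKK, hK3]
  have c2 : 28 * KP ^ 2 * K ^ 2 ≤ 32 * KP * K + 28 * KP ^ 2 * K ^ 2 + 12 * K ^ 3 * KP := by linarith only [hK1, hK3]
  have c3 : 12 * K ^ 3 * KP ≤ 32 * KP * K + 28 * KP ^ 2 * K ^ 2 + 12 * K ^ 3 * KP := by linarith only [hK1, hKK]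
  calc _ ≤ _ := h
    _ ≤ (32 * KP * K + 28 * KP ^ 2 * K ^ 2 + 12 * K ^ 3 * KP) * (((1 + Real.log (H : ℝ)) ^ 2 / β ^ 2 + s ^ 3 / (β * Real.sqrt β)) * Real.sqrt RU6) +
        (32 * KP * K + 28 * KP ^ 2 * K ^ 2 + 12 * K ^ 3 * KP) * ((1 + Real.log (H : ℝ)) ^ 2 / β ^ 2 * (Real.sqrt RU2 * Real.sqrt RU4)) +
        (32 * KP * K + 28 * KP ^ 2 * K ^ 2 + 12 * K ^ 3 * KP) * (((1 + Real.log (H : ℝ)) ^ 2 / β ^ 2 + s ^ 3 / (β * Real.sqrt β)) * (RU2 * Real.sqrt RU2)) :=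
        add_le_add_three (mul_le_mul_of_nonneg_right c1 X1) (mul_le_mul_of_nonneg_right c2 X2) (mul_le_mul_of_nonneg_right c3 X3)
    _ = _ := by ring

end GaussNormalForm

end Summit.QuantumFields.YangMills.Theorems.AllWindowsColdBoxBoxHighLine

end
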